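import Summits.QuantumFields.BalabanUV.Beta.FP.FineSplitJunctionWindows
import Summits.QuantumFields.BalabanUV.Beta.FP.MixLoopPowerCountingMass

/-!
# `BalabanUV.Beta.FP.FineSplitJunctionTwoLeg` — road «FP» for binder row D1, row KER-γ «THE JUNCTION», SOCKET (α0), ledger side (F):
# THE TWO-LEG ABSOLUTE CORE OF THE MASS-CURRENCY ENGINE (`MixLoopPowerCountingMass.coarse_mix2_secondMoment_le`, RHOA-6c′, RE-KEYED: the reference leg
# `J₁` at the anchor `v₀` and the running leg `J₂` SEPARATE, the two insertion masses `M₁`, `M₂` SEPARATE, the absolute value INSIDE the window sums) +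
# ITS JUNCTION COROLLARY in the input shape of `FineSplitJunctionWindows.rem_of_windows` — so that each `(c, e)`-term of an induced piece, whose two columns
# carry the DIFFERENT fibre pairs `(c, μ)` ∕ `(e, ν)` (`μ ≠ ν`), is served (LOCATED NOTE N-d1leaf01g11-2)

HONEST DEPENDENCY (page 1, mandatory): continuum YM on T⁴ ⇐ BetaPertH ∧ nine spine estimates (0/9 proved); BetaPertH ⇐ (D1) ∧ (D4) ∧
CAP+tail; G-an2-4 gates asym, D1 and NE2/3/4.  HONEST FRAMING (cell contract, verbatim): «discharging `BetaPertH` makes Bałaban's UV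
stability UNCONDITIONAL — a real constructive-QFT result; it is NOT the continuum limit and NOT the Clay problem.»  THIS MODULE is elementary [folklore]
real analysis on `ℤ⁴`: the owner's proof of `coarse_mix2_secondMoment_le` (steps 1–4) re-keyed symbol for symbol with two legs and two masses, over the same
helpers BY NAME (`MixLoopPowerCountingMass.sq_div_mul_exp_le`, `sq_coarse_sep_le`; `MixLoopPowerCounting.supNorm_cast_nonneg`); and one by-name composition
with `FineSplitJunctionWindows.rem_of_windows`.  R-FP-33 (c) clause: the pieces (G4) MIX-1…4 ∕ (G5) ghost-MIX of `KER-GAMMA-ALPHA2.md` §3 cannot be instantiated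
in the junction's ledger currency with the one-leg statements (N-d1leaf01g11-2); no existing file is touched.  No `def`, no `def … : Prop`, nothing cited,
nothing of the manuscripts under audit asserted, 0 sorry.  NOT the pointwise MIX shape of any piece (α2-a PART 2 ∕ α2-c owe it), NOT the (LEDGER), NOT hsplit,
NOT (ASYMP), NOT D1; 0∕4 row-D1 binders; NOT BetaPertH, NOT continuum, NOT Clay.

ABSOLUTE RULE (cell charter, verbatim): «No internally-minted statement may enter as a cited fact. Every hypothesis is either kernel-proved in this
package or a verbatim quotation of a PUBLISHED theorem with page reference. The manuscript(s) under audit are NOT citable for their own disputed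
steps — they are the thing under adjudication; programme-internal (2001/route/tribunal) claims are never citable.»

CONTENT ([folklore]): §1 **`coarse_secondMoment_abs_twoLeg`** (the two-leg absolute core; letters (J)(J′)(hk)(M₁)(M₂) displayed); the one-leg engine's
conclusion is recovered from it (`example`); §2 **`rem_window_of_twoLeg`** (the windowed anchor-form bound of `rem_of_windows` FROM per-`(c,e)` pointwise MIX shapes of
a matrix two-point piece and the columns' (J)(J′) letters), **`rem_of_twoLeg`** (composed with `rem_of_windows`: the ledger line of (α0)).
Provenance: D1 formalisation swarm LEAF PROVER 01, unit `b2b-balaban-beta-d1-formalise-leaf-01` gen 11, 2026-08-21, road FP rows KER-γ (α0) ∕ RHOA-6c′; «not in print; our bookkeeping».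
-/

noncomputable section

namespace Summit.QuantumFields.BalabanUV.Beta.FP.FineSplitJunctionTwoLeg

open Finset Real Filter Topology
open scoped BigOperators
open Literature.MathematicalPhysics.QuantumFieldTheory.Balaban1983to89
open Literature.MathematicalPhysics.QuantumFieldTheory.Balaban1983to89.Beta
open ExpKernelCalculus (Site MKer shiftK)
open OneStepResolventKernel (Fib)
open OneStepKernelFamily (colH)
open DyadicShell (Pt supNorm)
open GradedBubbles (supNorm_neg)
open Summit.QuantumFields.BalabanUV.Beta.D1BFx.MomentTransferPeriodic (IsBlockPeriodic)
open Summit.QuantumFields.BalabanUV.Beta.D1BFx.MomentTransferPeriodicEntry (EKer₂ dressedEntryP)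
open Summit.QuantumFields.BalabanUV.Beta.FP.TransportInfinityM (colOf)
open Summit.QuantumFields.BalabanUV.Beta.FP.MixLoopPowerCounting (supNorm_cast_nonneg)
open Summit.QuantumFields.BalabanUV.Beta.FP.MixLoopPowerCountingMass (sq_div_mul_exp_le sq_coarse_sep_le)
open Summit.QuantumFields.BalabanUV.Beta.FP.FineSplitJunctionWindows (rem_of_windows)

/-! ## §1 The two-leg absolute core -/

section Core

variable {S V : Finset Pt} {v₀ : Pt} {J₁ : Pt → ℝ} {J₂ : Pt → Pt → ℝ} {k : Pt → Pt → ℝ} {M₁ M₂ : Pt → ℝ}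
  {C_J C_J' E₀ A₁ A₂ δ : ℝ} {n : ℕ}

/-- **THE TWO-LEG ABSOLUTE CORE OF THE MASS-CURRENCY ENGINE** [folklore] (`0 < δ`, `1 ≤ n`, finite windows `S`, `V`, anchor `v₀`).  LETTERS: (J) the
reference leg `|J₁ b| ≤ C_J·e^{−(δ∕n)‖b − n•v₀‖∞}`; (J′) the running leg's coarse moments `Σ_{v∈V}(1 + (‖b′ − n•v‖∞∕n)²)·|J₂ b′ v| ≤ C_J′` for every `b′`;
(hk) the POINTWISE MIX SHAPE of the two-point piece `|k b b′| ≤ M₁ b·M₂ b′·E₀·e^{−(2δ∕n)‖b′ − b‖∞}` with `E₀, M₁, M₂ ≥ 0`; (M₁) `Σ_{b∈S} e^{−(δ∕(2n))‖b − n•v₀‖∞}·M₁ b ≤ A₁`;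
(M₂) `Σ_{b′∈S} e^{−(δ∕(2n))‖b′ − p‖∞}·M₂ b′ ≤ A₂` for every fine centre `p`.  THEN
`Σ_{v∈V} ‖v − v₀‖∞²·Σ_{b∈S}Σ_{b′∈S} |J₁ b|·|J₂ b′ v|·|k b b′| ≤ 3·(1 + 20∕δ²)·E₀·C_J·C_J′·A₁·A₂` — the owner's `coarse_mix2_secondMoment_le`, steps 1–4, with the
legs and masses separated and no outer absolute value. -/
theorem coarse_secondMoment_abs_twoLeg (hδ : 0 < δ) (hn : 1 ≤ n) (hE₀ : 0 ≤ E₀) (hM₁ : ∀ b, 0 ≤ M₁ b) (hM₂ : ∀ b, 0 ≤ M₂ b)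
    (hJ : ∀ b, |J₁ b| ≤ C_J * Real.exp (-(δ / n) * (supNorm (b - (n : ℤ) • v₀) : ℝ)))
    (hJ' : ∀ b', ∑ v ∈ V, (1 + ((supNorm (b' - (n : ℤ) • v) : ℝ) / n) ^ 2) * |J₂ b' v| ≤ C_J')
    (hk : ∀ b b', |k b b'| ≤ M₁ b * M₂ b' * E₀ * Real.exp (-(2 * δ / n) * (supNorm (b' - b) : ℝ)))
    (hA₁ : ∑ b ∈ S, Real.exp (-(δ / (2 * n)) * (supNorm (b - (n : ℤ) • v₀) : ℝ)) * M₁ b ≤ A₁)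
    (hA₂ : ∀ p : Pt, ∑ b' ∈ S, Real.exp (-(δ / (2 * n)) * (supNorm (b' - p) : ℝ)) * M₂ b' ≤ A₂) :
    ∑ v ∈ V, (supNorm (v - v₀) : ℝ) ^ 2 * ∑ b ∈ S, ∑ b' ∈ S, |J₁ b| * |J₂ b' v| * |k b b'|
      ≤ 3 * (1 + 20 / δ ^ 2) * E₀ * C_J * C_J' * A₁ * A₂ := by
  have hn' : (0 : ℝ) < n := by exact_mod_cast hn
  set dx : Pt → ℝ := fun b => (supNorm (b - (n : ℤ) • v₀) : ℝ) with hdx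
  set dy : Pt → Pt → ℝ := fun b b' => (supNorm (b' - b) : ℝ) with hdy
  set dz : Pt → Pt → ℝ := fun b' v => (supNorm (b' - (n : ℤ) • v) : ℝ) with hdz
  have hdx0 : ∀ b, 0 ≤ dx b := fun b => supNorm_cast_nonneg _
  have hdy0 : ∀ b b', 0 ≤ dy b b' := fun b b' => supNorm_cast_nonneg _
  have hdz0 : ∀ b' v, 0 ≤ dz b' v := fun b' v => supNorm_cast_nonneg _
  have hCJ : 0 ≤ C_J := by
    have h := hJ ((n : ℤ) • v₀)
    have e : Real.exp (-(δ / n) * (supNorm ((n : ℤ) • v₀ - (n : ℤ) • v₀) : ℝ)) = 1 := by simp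
    exact (abs_nonneg _).trans (by rw [e, mul_one] at h; exact h)
  have hCJ' : 0 ≤ C_J' := le_trans (Finset.sum_nonneg fun v _ => by positivity) (hJ' ((n : ℤ) • v₀))
  have hA₁0 : 0 ≤ A₁ := le_trans (Finset.sum_nonneg fun b _ => mul_nonneg (Real.exp_pos _).le (hM₁ b)) hA₁
  have hA₂0 : 0 ≤ A₂ := le_trans (Finset.sum_nonneg fun b _ => mul_nonneg (Real.exp_pos _).le (hM₂ b)) (hA₂ ((n : ℤ) • v₀))
  -- STEP 1: the pointwise shape inside the window sums
  have step1 : ∀ v ∈ V, (supNorm (v - v₀) : ℝ) ^ 2 * ∑ b ∈ S, ∑ b' ∈ S, |J₁ b| * |J₂ b' v| * |k b b'|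
      ≤ ∑ b ∈ S, ∑ b' ∈ S, (supNorm (v - v₀) : ℝ) ^ 2 *
          (|J₁ b| * |J₂ b' v| * (M₁ b * M₂ b' * E₀ * Real.exp (-(2 * δ / n) * dy b b'))) := by
    intro v _
    rw [Finset.mul_sum]
    refine Finset.sum_le_sum fun b _ => ?_
    rw [Finset.mul_sum]
    refine Finset.sum_le_sum fun b' _ => mul_le_mul_of_nonneg_left ?_ (by positivity)
    exact mul_le_mul_of_nonneg_left (hk b b') (mul_nonneg (abs_nonneg _) (abs_nonneg _))
  -- STEP 2: the coarse separation against the three fine separations; the squares are absorbed into half of the exponentials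
  have absorb : ∀ b b' v, (supNorm (v - v₀) : ℝ) ^ 2 * (Real.exp (-(δ / n) * dx b) * Real.exp (-(2 * δ / n) * dy b b'))
      ≤ 3 * ((16 / δ ^ 2 + 4 / δ ^ 2) + (dz b' v / n) ^ 2) *
          (Real.exp (-(δ / (2 * n)) * dx b) * Real.exp (-(δ / n) * dy b b')) := by
    intro b b' v
    have hsep := sq_coarse_sep_le hn v v₀ b b'
    have ex1 : Real.exp (-(δ / n) * dx b) = Real.exp (-(δ / (2 * n)) * dx b) * Real.exp (-(δ / (2 * n)) * dx b) := by
      rw [← Real.exp_add]; congr 1; field_simp; ring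
    have ex2 : Real.exp (-(2 * δ / n) * dy b b') = Real.exp (-(δ / n) * dy b b') * Real.exp (-(δ / n) * dy b b') := by
      rw [← Real.exp_add]; congr 1; ring
    have a1 : (dx b / n) ^ 2 * Real.exp (-(δ / (2 * n)) * dx b) ≤ 16 / δ ^ 2 := by
      have h := sq_div_mul_exp_le (c := δ / 2) (x := dx b) (by positivity) hn (hdx0 b)
      have e : -(δ / 2 / n) * dx b = -(δ / (2 * n)) * dx b := by field_simp
      rw [e] at h
      calc _ ≤ 4 / (δ / 2) ^ 2 := h
        _ = 16 / δ ^ 2 := by field_simp; ring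
    have a2 : (dy b b' / n) ^ 2 * Real.exp (-(δ / n) * dy b b') ≤ 4 / δ ^ 2 :=
      sq_div_mul_exp_le hδ hn (hdy0 b b')
    have hexA1 : Real.exp (-(δ / (2 * n)) * dx b) ≤ 1 :=
      Real.exp_le_one_iff.mpr (by have := hdx0 b; nlinarith [show 0 < δ / (2 * n) by positivity])
    have hexB1 : Real.exp (-(δ / n) * dy b b') ≤ 1 :=
      Real.exp_le_one_iff.mpr (by have := hdy0 b b'; nlinarith [show 0 < δ / n by positivity])
    rw [ex1, ex2]
    calc (supNorm (v - v₀) : ℝ) ^ 2 *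
          (Real.exp (-(δ / (2 * n)) * dx b) * Real.exp (-(δ / (2 * n)) * dx b) *
            (Real.exp (-(δ / n) * dy b b') * Real.exp (-(δ / n) * dy b b')))
        ≤ 3 * ((dx b / n) ^ 2 + (dy b b' / n) ^ 2 + (dz b' v / n) ^ 2) *
          (Real.exp (-(δ / (2 * n)) * dx b) * Real.exp (-(δ / (2 * n)) * dx b) *
            (Real.exp (-(δ / n) * dy b b') * Real.exp (-(δ / n) * dy b b'))) :=
          mul_le_mul_of_nonneg_right hsep (by positivity)
      _ = 3 * (((dx b / n) ^ 2 * Real.exp (-(δ / (2 * n)) * dx b)) * Real.exp (-(δ / n) * dy b b')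
            + ((dy b b' / n) ^ 2 * Real.exp (-(δ / n) * dy b b')) * Real.exp (-(δ / (2 * n)) * dx b)
            + (dz b' v / n) ^ 2 * (Real.exp (-(δ / (2 * n)) * dx b) * Real.exp (-(δ / n) * dy b b')))
            * (Real.exp (-(δ / (2 * n)) * dx b) * Real.exp (-(δ / n) * dy b b')) := by ring
      _ ≤ 3 * ((16 / δ ^ 2) * 1 + (4 / δ ^ 2) * 1 + (dz b' v / n) ^ 2 * (1 * 1))
            * (Real.exp (-(δ / (2 * n)) * dx b) * Real.exp (-(δ / n) * dy b b')) := by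
          apply mul_le_mul_of_nonneg_right _ (by positivity)
          apply mul_le_mul_of_nonneg_left _ (by norm_num)
          apply add_le_add (add_le_add _ _) _
          · exact mul_le_mul a1 hexB1 (Real.exp_pos _).le (by positivity)
          · exact mul_le_mul a2 hexA1 (Real.exp_pos _).le (by positivity)
          · exact mul_le_mul_of_nonneg_left (mul_le_mul hexA1 hexB1 (Real.exp_pos _).le zero_le_one) (by positivity)
      _ = _ := by ring
  -- STEP 3: for fixed b, b', sum over v using (J′)
  have step3 : ∀ b b', ∑ v ∈ V, (supNorm (v - v₀) : ℝ) ^ 2 *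
        (|J₁ b| * |J₂ b' v| * (M₁ b * M₂ b' * E₀ * Real.exp (-(2 * δ / n) * dy b b')))
      ≤ (3 * (1 + 20 / δ ^ 2) * E₀ * C_J * C_J') *
          (Real.exp (-(δ / (2 * n)) * dx b) * M₁ b) * (Real.exp (-(δ / n) * dy b b') * M₂ b') := by
    intro b b'
    have hv : ∀ v ∈ V, (supNorm (v - v₀) : ℝ) ^ 2 *
          (|J₁ b| * |J₂ b' v| * (M₁ b * M₂ b' * E₀ * Real.exp (-(2 * δ / n) * dy b b')))
        ≤ (3 * E₀ * C_J * M₁ b * M₂ b' * Real.exp (-(δ / (2 * n)) * dx b) * Real.exp (-(δ / n) * dy b b')) *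
            (((16 / δ ^ 2 + 4 / δ ^ 2) + (dz b' v / n) ^ 2) * |J₂ b' v|) := by
      intro v _
      have hJ'0 : 0 ≤ |J₂ b' v| := abs_nonneg _
      calc (supNorm (v - v₀) : ℝ) ^ 2 * (|J₁ b| * |J₂ b' v| * (M₁ b * M₂ b' * E₀ * Real.exp (-(2 * δ / n) * dy b b')))
          ≤ (supNorm (v - v₀) : ℝ) ^ 2 *
              ((C_J * Real.exp (-(δ / n) * dx b)) * |J₂ b' v| * (M₁ b * M₂ b' * E₀ * Real.exp (-(2 * δ / n) * dy b b'))) := by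
            apply mul_le_mul_of_nonneg_left _ (by positivity)
            exact mul_le_mul_of_nonneg_right (mul_le_mul_of_nonneg_right (hJ b) hJ'0)
              (mul_nonneg (mul_nonneg (mul_nonneg (hM₁ b) (hM₂ b')) hE₀) (Real.exp_pos _).le)
        _ = (C_J * |J₂ b' v| * (M₁ b * M₂ b' * E₀)) *
              ((supNorm (v - v₀) : ℝ) ^ 2 * (Real.exp (-(δ / n) * dx b) * Real.exp (-(2 * δ / n) * dy b b'))) := by ring
        _ ≤ (C_J * |J₂ b' v| * (M₁ b * M₂ b' * E₀)) *
              (3 * ((16 / δ ^ 2 + 4 / δ ^ 2) + (dz b' v / n) ^ 2) *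
                (Real.exp (-(δ / (2 * n)) * dx b) * Real.exp (-(δ / n) * dy b b'))) := by
            apply mul_le_mul_of_nonneg_left (absorb b b' v)
            exact mul_nonneg (mul_nonneg hCJ hJ'0) (mul_nonneg (mul_nonneg (hM₁ b) (hM₂ b')) hE₀)
        _ = _ := by ring
    refine (Finset.sum_le_sum hv).trans ?_
    rw [← Finset.mul_sum]
    have hsumv : ∑ v ∈ V, ((16 / δ ^ 2 + 4 / δ ^ 2) + (dz b' v / n) ^ 2) * |J₂ b' v| ≤ (1 + 20 / δ ^ 2) * C_J' := by
      have hterm : ∀ v ∈ V, ((16 / δ ^ 2 + 4 / δ ^ 2) + (dz b' v / n) ^ 2) * |J₂ b' v|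
          ≤ (1 + 20 / δ ^ 2) * ((1 + (dz b' v / n) ^ 2) * |J₂ b' v|) := by
        intro v _
        have hz0 : 0 ≤ (dz b' v / n) ^ 2 := by positivity
        have hδ2 : 0 ≤ 20 / δ ^ 2 := by positivity
        rw [← mul_assoc]
        refine mul_le_mul_of_nonneg_right ?_ (abs_nonneg _)
        rw [show (1 + 20 / δ ^ 2) * (1 + (dz b' v / n) ^ 2)
          = (16 / δ ^ 2 + 4 / δ ^ 2 + (dz b' v / n) ^ 2) + (1 + 20 / δ ^ 2 * (dz b' v / n) ^ 2) by ring]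
        linarith [mul_nonneg hδ2 hz0]
      refine (Finset.sum_le_sum hterm).trans ?_
      rw [← Finset.mul_sum]
      exact mul_le_mul_of_nonneg_left (hJ' b') (by positivity)
    have hpre : 0 ≤ 3 * E₀ * C_J * M₁ b * M₂ b' * Real.exp (-(δ / (2 * n)) * dx b) * Real.exp (-(δ / n) * dy b b') :=
      mul_nonneg (mul_nonneg (mul_nonneg (mul_nonneg (mul_nonneg (mul_nonneg (by norm_num) hE₀) hCJ) (hM₁ b)) (hM₂ b'))
        (Real.exp_pos _).le) (Real.exp_pos _).le
    calc (3 * E₀ * C_J * M₁ b * M₂ b' * Real.exp (-(δ / (2 * n)) * dx b) * Real.exp (-(δ / n) * dy b b')) *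
          ∑ v ∈ V, ((16 / δ ^ 2 + 4 / δ ^ 2) + (dz b' v / n) ^ 2) * |J₂ b' v|
        ≤ (3 * E₀ * C_J * M₁ b * M₂ b' * Real.exp (-(δ / (2 * n)) * dx b) * Real.exp (-(δ / n) * dy b b')) *
          ((1 + 20 / δ ^ 2) * C_J') := mul_le_mul_of_nonneg_left hsumv hpre
      _ = _ := by ring
  -- STEP 4: sum over b' with (M₂) at centre b and rate δ/n ≥ δ/(2n), then over b with (M₁)
  have hMb' : ∀ b, ∑ b' ∈ S, Real.exp (-(δ / n) * dy b b') * M₂ b' ≤ A₂ := by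
    intro b
    refine (Finset.sum_le_sum fun b' _ => mul_le_mul_of_nonneg_right (Real.exp_le_exp.mpr ?_) (hM₂ b')).trans (hA₂ b)
    have h0 := hdy0 b b'
    show -(δ / n) * dy b b' ≤ -(δ / (2 * n)) * (supNorm (b' - b) : ℝ)
    simp only [hdy]
    have hrate : δ / (2 * n) ≤ δ / n := by rw [div_le_div_iff₀ (by positivity) hn']; nlinarith
    nlinarith
  have hK0 : 0 ≤ 3 * (1 + 20 / δ ^ 2) * E₀ * C_J * C_J' :=
    mul_nonneg (mul_nonneg (mul_nonneg (mul_nonneg (by norm_num) (by positivity)) hE₀) hCJ) hCJ'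
  calc ∑ v ∈ V, (supNorm (v - v₀) : ℝ) ^ 2 * ∑ b ∈ S, ∑ b' ∈ S, |J₁ b| * |J₂ b' v| * |k b b'|
      ≤ ∑ v ∈ V, ∑ b ∈ S, ∑ b' ∈ S, (supNorm (v - v₀) : ℝ) ^ 2 *
          (|J₁ b| * |J₂ b' v| * (M₁ b * M₂ b' * E₀ * Real.exp (-(2 * δ / n) * dy b b'))) := Finset.sum_le_sum step1
    _ = ∑ b ∈ S, ∑ b' ∈ S, ∑ v ∈ V, (supNorm (v - v₀) : ℝ) ^ 2 *
          (|J₁ b| * |J₂ b' v| * (M₁ b * M₂ b' * E₀ * Real.exp (-(2 * δ / n) * dy b b'))) := by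
        rw [Finset.sum_comm]
        refine Finset.sum_congr rfl fun b _ => ?_
        rw [Finset.sum_comm]
    _ ≤ ∑ b ∈ S, ∑ b' ∈ S, (3 * (1 + 20 / δ ^ 2) * E₀ * C_J * C_J') *
          (Real.exp (-(δ / (2 * n)) * dx b) * M₁ b) * (Real.exp (-(δ / n) * dy b b') * M₂ b') :=
        Finset.sum_le_sum fun b _ => Finset.sum_le_sum fun b' _ => step3 b b'
    _ = (3 * (1 + 20 / δ ^ 2) * E₀ * C_J * C_J') *
          ∑ b ∈ S, (Real.exp (-(δ / (2 * n)) * dx b) * M₁ b) * ∑ b' ∈ S, (Real.exp (-(δ / n) * dy b b') * M₂ b') := by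
        rw [Finset.mul_sum]
        refine Finset.sum_congr rfl fun b _ => ?_
        rw [Finset.mul_sum, Finset.mul_sum]
        refine Finset.sum_congr rfl fun b' _ => ?_
        ring
    _ ≤ (3 * (1 + 20 / δ ^ 2) * E₀ * C_J * C_J') * ∑ b ∈ S, (Real.exp (-(δ / (2 * n)) * dx b) * M₁ b) * A₂ := by
        apply mul_le_mul_of_nonneg_left _ hK0
        exact Finset.sum_le_sum fun b _ => mul_le_mul_of_nonneg_left (hMb' b) (mul_nonneg (Real.exp_pos _).le (hM₁ b))
    _ = (3 * (1 + 20 / δ ^ 2) * E₀ * C_J * C_J') * ((∑ b ∈ S, Real.exp (-(δ / (2 * n)) * dx b) * M₁ b) * A₂) := by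
        rw [Finset.sum_mul]
    _ ≤ (3 * (1 + 20 / δ ^ 2) * E₀ * C_J * C_J') * (A₁ * A₂) := by
        apply mul_le_mul_of_nonneg_left _ hK0
        exact mul_le_mul_of_nonneg_right hA₁ hA₂0
    _ = 3 * (1 + 20 / δ ^ 2) * E₀ * C_J * C_J' * A₁ * A₂ := by ring

/-- [folklore] CONSISTENCY: the one-leg SIGNED engine shape follows from the two-leg absolute core (`J₁ := J · v₀`, `J₂ := J`, `M₁ = M₂ = M`, `|Σ| ≤ Σ|·|`). -/
example (hδ : 0 < δ) (hn : 1 ≤ n) {J : Pt → Pt → ℝ} {M : Pt → ℝ} (hE₀ : 0 ≤ E₀) (hM : ∀ b, 0 ≤ M b)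
    (hJ : ∀ b, |J b v₀| ≤ C_J * Real.exp (-(δ / n) * (supNorm (b - (n : ℤ) • v₀) : ℝ)))
    (hJ' : ∀ b', ∑ v ∈ V, (1 + ((supNorm (b' - (n : ℤ) • v) : ℝ) / n) ^ 2) * |J b' v| ≤ C_J')
    (hk : ∀ b b', |k b b'| ≤ M b * M b' * E₀ * Real.exp (-(2 * δ / n) * (supNorm (b' - b) : ℝ)))
    (hA : ∀ p : Pt, ∑ b ∈ S, Real.exp (-(δ / (2 * n)) * (supNorm (b - p) : ℝ)) * M b ≤ A₁) :
    ∑ v ∈ V, (supNorm (v - v₀) : ℝ) ^ 2 * |∑ b ∈ S, ∑ b' ∈ S, J b v₀ * J b' v * k b b'|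
      ≤ 3 * (1 + 20 / δ ^ 2) * E₀ * C_J * C_J' * A₁ * A₁ := by
  have h := coarse_secondMoment_abs_twoLeg (J₁ := fun b => J b v₀) (J₂ := J) hδ hn hE₀ hM hM hJ hJ' hk (hA _) hA
  refine le_trans (Finset.sum_le_sum fun v _ => mul_le_mul_of_nonneg_left ?_ (by positivity)) h
  refine (Finset.abs_sum_le_sum_abs _ _).trans (Finset.sum_le_sum fun b _ =>
    (Finset.abs_sum_le_sum_abs _ _).trans (Finset.sum_le_sum fun b' _ => ?_))
  rw [abs_mul, abs_mul]

end Core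

/-! ## §2 The junction corollary: the windowed anchor-form bound from per-`(c,e)` pointwise MIX shapes -/

section Junction

variable {N : ℕ} {K : MKer (3 + 1) (Fib 3)} {G : EKer₂ 4} {a b : Fin 4}
  {M₁ M₂ : Fin 4 → Fin 4 → Pt → ℝ} {C_J C_J' E₀ A₁ A₂ δ : ℝ}

/-- **THE WINDOWED ANCHOR-FORM BOUND OF AN INDUCED PIECE FROM POINTWISE MIX SHAPES** [folklore] (`0 < δ`, `1 ≤ N`): a matrix two-point piece `G` with, for
every fibre pair `(c, e)`, the pointwise shape `|G c e p x| ≤ M₁ c e p·M₂ c e x·E₀·e^{−(2δ∕N)‖x − p‖∞}` (`E₀, M₁, M₂ ≥ 0`) and the two mass letters at every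
fine centre (`A₁` for `M₁`, `A₂` for `M₂`), and columns of `K` with (J) `|colH K N a 0 c p| ≤ C_J·e^{−(δ∕N)‖p − N•0‖∞}` (anchor `0`, every `c`) and (J′)
`∀ x, Σ_{u∈S′}(1 + (‖x − N•u‖∞∕N)²)·|colH K N b u e x| ≤ C_J′` (every `e`, every finite coarse `S′`) ⟹ for every finite coarse `S′` and fine square window `A`:
`Σ_{u∈S′}‖u‖∞²·|Σ_{c,e}Σ_{p∈A}Σ_{x∈A} colH K N a 0 c p·G c e p x·colH K N b u e x| ≤ 16·(3·(1 + 20∕δ²)·E₀·C_J·C_J′·A₁·A₂)` — the input of `rem_of_windows`. -/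
theorem rem_window_of_twoLeg (hδ : 0 < δ) (hN : 1 ≤ N) (hE₀ : 0 ≤ E₀) (hM₁ : ∀ c e p, 0 ≤ M₁ c e p) (hM₂ : ∀ c e p, 0 ≤ M₂ c e p)
    (hG : ∀ (c e : Fin 4) (p x : Pt), |G c e p x| ≤ M₁ c e p * M₂ c e x * E₀ * Real.exp (-(2 * δ / N) * (supNorm (x - p) : ℝ)))
    (hA₁ : ∀ (c e : Fin 4) (q : Pt) (A : Finset Pt), ∑ p ∈ A, Real.exp (-(δ / (2 * N)) * (supNorm (p - q) : ℝ)) * M₁ c e p ≤ A₁)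
    (hA₂ : ∀ (c e : Fin 4) (q : Pt) (A : Finset Pt), ∑ x ∈ A, Real.exp (-(δ / (2 * N)) * (supNorm (x - q) : ℝ)) * M₂ c e x ≤ A₂)
    (hJ : ∀ (c : Fin 4) (p : Pt), |colH K N a 0 c p| ≤ C_J * Real.exp (-(δ / N) * (supNorm (p - (N : ℤ) • (0 : Pt)) : ℝ)))
    (hJ' : ∀ (e : Fin 4) (S' : Finset Pt) (x : Pt), ∑ u ∈ S', (1 + ((supNorm (x - (N : ℤ) • u) : ℝ) / N) ^ 2) * |colH K N b u e x| ≤ C_J')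
    (S' A : Finset Pt) :
    ∑ u ∈ S', (supNorm u : ℝ) ^ 2 * |∑ c, ∑ e, ∑ p ∈ A, ∑ x ∈ A, colH K N a 0 c p * G c e p x * colH K N b u e x|
      ≤ 16 * (3 * (1 + 20 / δ ^ 2) * E₀ * C_J * C_J' * A₁ * A₂) := by
  -- per (c, e): the two-leg core with `v₀ := 0`, `J₁ := colH … c`, `J₂ x u := colH K N b u e x`, `k := G c e`
  have hce : ∀ c e : Fin 4, ∑ u ∈ S', (supNorm (u - 0) : ℝ) ^ 2 * ∑ p ∈ A, ∑ x ∈ A, |colH K N a 0 c p| * |colH K N b u e x| * |G c e p x|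
      ≤ 3 * (1 + 20 / δ ^ 2) * E₀ * C_J * C_J' * A₁ * A₂ := fun c e =>
    coarse_secondMoment_abs_twoLeg (S := A) (V := S') (v₀ := 0) (J₁ := fun p => colH K N a 0 c p) (J₂ := fun x u => colH K N b u e x)
      (k := G c e) (M₁ := M₁ c e) (M₂ := M₂ c e) hδ hN hE₀ (hM₁ c e) (hM₂ c e) (hJ c) (hJ' e S') (hG c e)
      (by simpa using hA₁ c e ((N : ℤ) • (0 : Pt)) A) (fun q => hA₂ c e q A)
  -- triangle over (c, e) and reorder the factors
  have htri : ∀ u ∈ S', (supNorm u : ℝ) ^ 2 * |∑ c, ∑ e, ∑ p ∈ A, ∑ x ∈ A, colH K N a 0 c p * G c e p x * colH K N b u e x|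
      ≤ ∑ c, ∑ e, (supNorm (u - 0) : ℝ) ^ 2 * ∑ p ∈ A, ∑ x ∈ A, |colH K N a 0 c p| * |colH K N b u e x| * |G c e p x| := by
    intro u _
    have hin : |∑ c, ∑ e, ∑ p ∈ A, ∑ x ∈ A, colH K N a 0 c p * G c e p x * colH K N b u e x|
        ≤ ∑ c, ∑ e, ∑ p ∈ A, ∑ x ∈ A, |colH K N a 0 c p| * |colH K N b u e x| * |G c e p x| := by
      refine (Finset.abs_sum_le_sum_abs _ _).trans (Finset.sum_le_sum fun c _ =>
        (Finset.abs_sum_le_sum_abs _ _).trans (Finset.sum_le_sum fun e _ =>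
          (Finset.abs_sum_le_sum_abs _ _).trans (Finset.sum_le_sum fun p _ =>
            (Finset.abs_sum_le_sum_abs _ _).trans (Finset.sum_le_sum fun x _ => le_of_eq ?_))))
      rw [abs_mul, abs_mul]; ring
    calc (supNorm u : ℝ) ^ 2 * |∑ c, ∑ e, ∑ p ∈ A, ∑ x ∈ A, colH K N a 0 c p * G c e p x * colH K N b u e x|
        ≤ (supNorm u : ℝ) ^ 2 * ∑ c, ∑ e, ∑ p ∈ A, ∑ x ∈ A, |colH K N a 0 c p| * |colH K N b u e x| * |G c e p x| :=
          mul_le_mul_of_nonneg_left hin (by positivity)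
      _ = _ := by
          rw [sub_zero, Finset.mul_sum]
          exact Finset.sum_congr rfl fun c _ => Finset.mul_sum _ _ _
  calc ∑ u ∈ S', (supNorm u : ℝ) ^ 2 * |∑ c, ∑ e, ∑ p ∈ A, ∑ x ∈ A, colH K N a 0 c p * G c e p x * colH K N b u e x|
      ≤ ∑ u ∈ S', ∑ c, ∑ e, (supNorm (u - 0) : ℝ) ^ 2 * ∑ p ∈ A, ∑ x ∈ A, |colH K N a 0 c p| * |colH K N b u e x| * |G c e p x| :=
        Finset.sum_le_sum htri
    _ = ∑ c, ∑ e, ∑ u ∈ S', (supNorm (u - 0) : ℝ) ^ 2 * ∑ p ∈ A, ∑ x ∈ A, |colH K N a 0 c p| * |colH K N b u e x| * |G c e p x| := by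
        rw [Finset.sum_comm]
        exact Finset.sum_congr rfl fun c _ => Finset.sum_comm
    _ ≤ ∑ _c : Fin 4, ∑ _e : Fin 4, 3 * (1 + 20 / δ ^ 2) * E₀ * C_J * C_J' * A₁ * A₂ :=
        Finset.sum_le_sum fun c _ => Finset.sum_le_sum fun e _ => hce c e
    _ = 16 * (3 * (1 + 20 / δ ^ 2) * E₀ * C_J * C_J' * A₁ * A₂) := by
        rw [Finset.sum_const, Finset.sum_const, Finset.card_univ, Fintype.card_fin]
        simp only [nsmul_eq_mul]
        push_cast
        ring

/-- **THE LEDGER LINE OF (α0) FROM POINTWISE MIX SHAPES** [folklore]: §2's windowed bound composed with `FineSplitJunctionWindows.rem_of_windows` — `K`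
block-covariant with absolutely summable END columns, `G` bounded and block-periodic entrywise with the per-`(c,e)` pointwise MIX shape and mass letters,
columns with (J)(J′) ⟹ `∀ S′, Σ_{u∈S′}‖u‖∞²·|dressedEntryP (c a′ ↦ colH K N a′ 0 c) G (N•(−u)) a b| ≤ 16·(3·(1 + 20∕δ²)·E₀·C_J·C_J′·A₁·A₂)`. -/
theorem rem_of_twoLeg (hδ : 0 < δ) (hN : 1 ≤ N) (hKcov : ∀ t : Fin (3 + 1) → ℤ, shiftK (-((N : ℤ) • t)) K = K)
    (hcol : ∀ κ l : Fin 4, Summable fun x => |colOf K κ l x|)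
    (hGper : ∀ c e, IsBlockPeriodic N (G c e)) (hGb : ∀ c e, ∃ A, ∀ s s', |G c e s s'| ≤ A)
    (hE₀ : 0 ≤ E₀) (hM₁ : ∀ c e p, 0 ≤ M₁ c e p) (hM₂ : ∀ c e p, 0 ≤ M₂ c e p)
    (hG : ∀ (c e : Fin 4) (p x : Pt), |G c e p x| ≤ M₁ c e p * M₂ c e x * E₀ * Real.exp (-(2 * δ / N) * (supNorm (x - p) : ℝ)))
    (hA₁ : ∀ (c e : Fin 4) (q : Pt) (A : Finset Pt), ∑ p ∈ A, Real.exp (-(δ / (2 * N)) * (supNorm (p - q) : ℝ)) * M₁ c e p ≤ A₁)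
    (hA₂ : ∀ (c e : Fin 4) (q : Pt) (A : Finset Pt), ∑ x ∈ A, Real.exp (-(δ / (2 * N)) * (supNorm (x - q) : ℝ)) * M₂ c e x ≤ A₂)
    (hJ : ∀ (c : Fin 4) (p : Pt), |colH K N a 0 c p| ≤ C_J * Real.exp (-(δ / N) * (supNorm (p - (N : ℤ) • (0 : Pt)) : ℝ)))
    (hJ' : ∀ (e : Fin 4) (S' : Finset Pt) (x : Pt), ∑ u ∈ S', (1 + ((supNorm (x - (N : ℤ) • u) : ℝ) / N) ^ 2) * |colH K N b u e x| ≤ C_J') :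
    ∀ S' : Finset Pt, ∑ u ∈ S', (supNorm u : ℝ) ^ 2 * |dressedEntryP (fun c a' => colH K N a' 0 c) G ((N : ℤ) • (-u)) a b|
      ≤ 16 * (3 * (1 + 20 / δ ^ 2) * E₀ * C_J * C_J' * A₁ * A₂) :=
  rem_of_windows hKcov hcol hGper hGb fun S' A => rem_window_of_twoLeg hδ hN hE₀ hM₁ hM₂ hG hA₁ hA₂ hJ hJ' S' A

end Junction

end Summit.QuantumFields.BalabanUV.Beta.FP.FineSplitJunctionTwoLeg

end
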